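import Mathlib
import Summits.Ventures.PercRepro2.SwOutCrossBaseType

/-!
# The cross base: the type lemma with the mark anywhere but at `u` or a dropped vertex (blind cell
PercRepro2, night-4 g23, 2026-08-28; proofs/NIGHT4-G23.md §10, step (3), the mark's position)

`conn_mono` and the type lemma asked the mark `o` to lie outside the structure. Here `o` may also
lie in a u-arm or a far arm (an arm red-reached from `l` is blue, a hub, and stays blue at the
better point; the crossing segment reaching `o` ends inside that arm). The mark may NOT be `u` or a
dropped vertex `p i`: `u` red-reached through a red u-edge of a red port, or a blue port
red-reached through a red link, is not recorded by the label (the red links between red ports),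
so red connection to `u` or to `p i` is not monotone in the type — exactly the positions
`MixedJunctionR` excludes (`o ≠ u`, `o ≠ p r`).
-/

namespace Summit.Ventures.PercRepro2

namespace CrossArm

open Hull LocRows

variable {V E : Type*}

open scoped Classical

section Mark

variable {ends : E → Sym2 V} {σ : Config E} {h u : V} {ι X κ : Type*} {U : ι → Set V}
  {p : X → V} {G : SimpleGraph X} {F : κ → Set V} (hb : CrossBase ends σ h u U p G F)
include hb

/-- **Red connection from outside the structure to a vertex other than `u` and the dropped
vertices is monotone in the type** (`conn_mono` with the mark anywhere but at `u`, `p i`). -/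
theorem CrossBase.conn_mono_mark (hup : ∀ i, ∃ e, ends e = s(u, p i))
    (hcross : ∀ i j, G.Adj i j → ∃ e, ends e = s(p i, p j)) {x x' : PtXG ι κ X G}
    (hxL : ¬ LeakRX G x) (harm : ∀ j, x.2.1 j = false → x'.2.1 j = false)
    (hfar : ∀ k, x.1 k = false → x'.1 k = false)
    (hext : ∀ i, x.2.2.2.2 i = false → x'.2.2.2.2 i = false)
    (hlink : ∀ i m, x.2.2.2.2 i = false → x.2.2.2.2 m = false → rlinkE G x.2.2 i m →
      rlinkE G x'.2.2 i m)
    {l o : V} (hl : l ∉ strX h u U p F) (hou : o ≠ u) (hop : ∀ i, o ≠ p i)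
    (hlh : ¬ Conn ends (crossReal ends u U p G F σ x) l h)
    (hlo : Conn ends (crossReal ends u U p G F σ x) l o) :
    Conn ends (crossReal ends u U p G F σ x') l o := by
  by_cases ho : o ∈ strX h u U p F
  · -- the red walk from `l` ends inside the structure: its last crossing segment reaches `o`
    have key : ∀ v, Conn ends (crossReal ends u U p G F σ x) l v →
        (v ∉ strX h u U p F ∧ Conn ends (crossReal ends u U p G F σ x') l v) ∨
          ∃ a, a ∉ strX h u U p F ∧ Conn ends (crossReal ends u U p G F σ x') l a ∧
            Conn ends (crossReal ends u U p G F σ x) l a ∧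
            SegX ends (crossReal ends u U p G F σ x) (strX h u U p F) a v := by
      intro v hv
      rw [Conn, SimpleGraph.reachable_iff_reflTransGen] at hv
      induction hv with
      | refl => exact Or.inl ⟨hl, conn_refl _ _ _⟩
      | @tail b c hab hbc ih =>
        by_cases hc : c ∈ strX h u U p F
        · rcases ih with ⟨hbO, hb'⟩ | ⟨a, haO, ha', hla, hseg⟩
          · refine Or.inr ⟨b, hbO, hb', ?_, Relation.ReflTransGen.single ⟨hbc, hc⟩⟩
            rw [Conn, SimpleGraph.reachable_iff_reflTransGen]
            exact hab
          · exact Or.inr ⟨a, haO, ha', hla, hseg.tail ⟨hbc, hc⟩⟩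
        · rcases ih with ⟨hbO, hb'⟩ | ⟨a, haO, ha', hla, hseg⟩
          · obtain ⟨hne, e, he, hends⟩ := exists_edge_of_adj hbc
            refine Or.inl ⟨hc, conn_trans hb'
              (SimpleGraph.Adj.reachable (adj_of_edge hne ?_ hends))⟩
            rw [hb.crossReal_apply_out hends hbO hc]
            rw [hb.crossReal_apply_out hends hbO hc] at he
            exact he
          · have hah : ¬ Conn ends (crossReal ends u U p G F σ x) h a :=
              fun hha => hlh (conn_trans hla (conn_symm hha))
            have hinv := hb.crossInv_of_segX hup hcross hxL harm hfar haO hah hseg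
            exact Or.inl ⟨hc, conn_trans ha'
              (hb.conn_of_crossInv hup hcross harm hfar hext hlink haO hinv hbc hc)⟩
    rcases key o hlo with ⟨ho', -⟩ | ⟨a, haO, ha', hla, hseg⟩
    · exact absurd ho ho'
    · have hah : ¬ Conn ends (crossReal ends u U p G F σ x) h a :=
        fun hha => hlh (conn_trans hla (conn_symm hha))
      rcases hb.crossInv_of_segX hup hcross hxL harm hfar haO hah hseg with
        hoa | ⟨j, -, -, hconn⟩ | ⟨k, -, -, hconn⟩ | ⟨i, -, -, ov, hvo, -⟩
      · rw [hoa]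
        exact ha'
      · exact conn_trans ha' hconn
      · exact conn_trans ha' hconn
      · rcases ov with _ | m
        · exact absurd hvo hou
        · exact absurd hvo (hop m)
  · exact hb.conn_mono hup hcross hxL harm hfar hext hlink hl ho hlh hlo

end Mark

section MarkType

variable {ends : E → Sym2 V} {σ : Config E} {h u : V} {ι X κ : Type*} {U : ι → Set V}
  {p : X → V} {G : SimpleGraph X} {F : κ → Set V} [Fintype X] [DecidableEq X]
  [DecidableRel G.Adj] [Nonempty X] (hG : G.Connected) (hb : CrossBase ends σ h u U p G F)
include hb

/-- **Blue connection is antitone in the type, the mark anywhere but at `u`, `p i`.** -/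
theorem CrossBase.conn_blue_anti_mark (hup : ∀ i, ∃ e, ends e = s(u, p i))
    (hcross : ∀ i j, G.Adj i j → ∃ e, ends e = s(p i, p j)) {x x' : PtXG ι κ X G}
    (hx'B : ¬ LeakBX G x')
    (hord : BetterFG (fibKEE G hG) (typFG (fibKEE G hG) (toGen G x'))
      (typFG (fibKEE G hG) (toGen G x)))
    {l o : V} (hl : l ∉ strX h u U p F) (hou : o ≠ u) (hop : ∀ i, o ≠ p i)
    (hlh : ¬ Conn ends (blue (crossReal ends u U p G F σ x')) l h)
    (hlo : Conn ends (blue (crossReal ends u U p G F σ x')) l o) :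
    Conn ends (blue (crossReal ends u U p G F σ x)) l o := by
  rw [hb.blue_crossReal] at hlh hlo ⊢
  obtain ⟨hfar, harm, hext, hlink, -⟩ := (betterFG_iff hG).1 (betterFG_flip hG hord)
  exact hb.dual.conn_mono_mark hup hcross hx'B harm hfar hext
    (fun i m hi hm hr => (hlink i m ⟨hi, hm, hr⟩).2.2) hl hou hop hlh hlo

/-- **THE TYPE LEMMA, the mark anywhere but at `u`, `p i`.** For non-leaking points `x ≤ x'`,
`l` outside the structure and `o ≠ u`, `o ≠ p i`: if the realisation of `x` lies in the
pulled-back conditioning `tgtU l h {S | o ∈ S}`, so does the realisation of `x'`. -/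
theorem CrossBase.mem_tgtU_of_betterFG_mark [Fintype E] [DecidableEq E]
    (hup : ∀ i, ∃ e, ends e = s(u, p i))
    (hcross : ∀ i j, G.Adj i j → ∃ e, ends e = s(p i, p j)) {x x' : PtXG ι κ X G}
    (hxR : ¬ LeakRX G x) (hx'R : ¬ LeakRX G x') (hx'B : ¬ LeakBX G x')
    (hord : BetterFG (fibKEE G hG) (typFG (fibKEE G hG) (toGen G x'))
      (typFG (fibKEE G hG) (toGen G x)))
    {l o : V} (hl : l ∉ strX h u U p F) (hou : o ≠ u) (hop : ∀ i, o ≠ p i)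
    (hx : crossReal ends u U p G F σ x ∈ tgtU ends l h {S | o ∈ S}) :
    crossReal ends u U p G F σ x' ∈ tgtU ends l h {S | o ∈ S} := by
  simp only [tgtU, Finset.mem_filter, Finset.mem_univ, true_and, Set.mem_setOf_eq,
    mem_cluster] at hx ⊢
  obtain ⟨hxh, hxo, hxb⟩ := hx
  obtain ⟨hfar, harm, hext, hlink, -⟩ := (betterFG_iff hG).1 hord
  have hlh : ¬ Conn ends (crossReal ends u U p G F σ x) l h := fun hc => hxh (Or.inl hc)
  have h1 : h ∉ hull ends (crossReal ends u U p G F σ x') l := by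
    intro hh
    have hlh' : l ∈ hull ends (crossReal ends u U p G F σ x') h := by
      rcases hh with hh | hh
      · exact Or.inl (conn_symm hh)
      · exact Or.inr (conn_symm hh)
    exact hl (hb.hull_crossReal_subset hup hcross hx'R hx'B hlh')
  refine ⟨h1, ?_, ?_⟩
  · exact hb.conn_mono_mark hup hcross hxR harm hfar hext
      (fun i m hi hm hr => (hlink i m ⟨hi, hm, hr⟩).2.2) hl hou hop hlh hxo
  · intro hc
    exact hxb (hb.conn_blue_anti_mark hG hup hcross hx'B hord hl hou hop
      (fun hc' => h1 (Or.inr hc')) hc)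

end MarkType

end CrossArm

end Summit.Ventures.PercRepro2
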